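import Mathlib
import Literature.AlgebraicGeometry.Resolution.FormalInverseFunction
import Summits.ResolutionOfSingularities.ResolutionOfSingularities.Theorems.WeightedInvariantLocalWeightedDropTOT2BridgePoint
import Summits.ResolutionOfSingularities.ResolutionOfSingularities.Theorems.WeightedInvariantLocalWeightedDropNCResSettingNear
import Summits.ResolutionOfSingularities.ResolutionOfSingularities.Theorems.WeightedInvariantLocalWeightedDropNCResSettingAdmissible

/-!
# `WeightedInvariant.LocalWeightedDrop`, residual T″|₄ (skeleton v32, registered stub `stub_spaceNCRankDrop`): TOT2-LINE piece S-E2,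
# (E2-c) THE COUNT-GAME BRIDGE — the δ-ADAPTER: the successor monic form IS the new decoration's `f′ · ∏_{O′} x_l`

Crux item stmt-ResolutionOfSingularities-8899 `LocalWeightedDrop`; line TOT2-LINE v1 of res-L1-w43-lead-1, piece S-E2 (E2-c) (res-L1-w43-stub-2,
res-L1-w43-plan-1 DEALS gen 10 #9); companion of …TOT2BridgePoint / …TOT2BridgeCurve / …TOT2BridgeLabels (p530471 / p531619 / p532664), on top of
res-L1-w43-stub-1's S-SET (…NCResSettingDefs/…Strict/…Admissible/…Near) and res-L1-w43-strat-1's product trick (P) (CRITIQUE-TOT2-v1: the label is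
the monic form of `g = f · ∏_{l∈O} x_l`).  [OURS · L1 W4.3, chain w43, res-L1-w43-stub-2 (gen 4); nothing about any manuscript; definition-free.]

* `exists_legal_inverse` — the formal inverse of a legal coordinate change (Resolution.FormalInverseFunction `exists_comp_inverse`) packaged for
  S-ASM: two-sided on series, legal, and EXPLICIT `x_l ↦ a⁻¹ x_l` on every letter the change rescales (so it straightens the boundary).
* `satPart_fChart_mul_eq` — THE CORE IDENTITY of the point move at an answer `pt`: for a B-permissible `(Φ₀, 𝟙)` and a presentation
  `(f · ∏_O x_l) ∘ Φ₀ = U · (y^d + Σ A_j y^j)` with a positive label `A`,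
  `satPart(f-chart) · W · ∏_{l∈O} (pt_{σl} + y_{σl}) = (U∘chart) · g₀`, `W(0) ≠ 0`, `g₀` the weighted brick's bracket (`σ = strIdx Φ₀`).
* `constantCoeff_strict_ne_zero_of_gamma_ne_zero` — answers with `γ = pt(y) ≠ 0`: the sliced strict transform is a UNIT, so the new decoration
  has `o′ = 0` (`o_transform_eq_zero_of_gamma_ne_zero`): a head drop (or terminal by S-SET (T0)).
* `strict_mul_prod_eq_of_gamma_eq_zero` — answers with `γ = 0`, live slot `x_{i₀}`: `strict · ∏_{through-going old letters} = V · (successor monic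
  form)`, hence at a NEAR point (`o′ = o`) `f′ · ∏_{l∈O′} x_l = V · (y^d + Σ_j (s·B_j)|_{i₀} y^j)` (`totalO_transform_eq_of_near`) — with
  …TOT2BridgeLabels this is `unit · Θ^*(monic form of the succT-label)`, the input of the next step after `Θ⁻¹`.
-/

set_option linter.dupNamespace false -- mandated namespace of this single-conjunct summit
set_option autoImplicit false

namespace Summit.ResolutionOfSingularities.ResolutionOfSingularities.Theorems

open Literature.AlgebraicGeometry.Resolution
open Literature.AlgebraicGeometry.Resolution.CobordantGame

namespace TameFourTupleDrop

open MvPowerSeries MonicPointBlowup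

variable {k : Type} [Field k] {m : ℕ}

/-! ## Legal inverses, explicit on rescaled letters -/

/-- **LEGAL COORDINATE CHANGES HAVE LEGAL INVERSES, EXPLICIT ON RESCALED LETTERS.**  For `Θ` with zero constant terms and invertible linear part
there is `Ψ` with zero constant terms and invertible linear part such that `Ψ^* ∘ Θ^* = id = Θ^* ∘ Ψ^*` on series, and whenever `Θ` rescales a
letter, `Θ_l = a · x_l` (`a ≠ 0`), then `Ψ_l = a⁻¹ · x_l`. [OURS · L1 W4.3] -/
theorem exists_legal_inverse {n : ℕ} {Θ : Fin n → MvPowerSeries (Fin n) k} (h0 : ∀ i, constantCoeff (Θ i) = 0)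
    (hdet : IsUnit (FormalCoordChange.linMat Θ).det) :
    ∃ Ψ : Fin n → MvPowerSeries (Fin n) k, (∀ i, constantCoeff (Ψ i) = 0) ∧ IsUnit (FormalCoordChange.linMat Ψ).det ∧
      (∀ F, subst Ψ (subst Θ F) = F) ∧ (∀ F, subst Θ (subst Ψ F) = F) ∧
      ∀ (l : Fin n) (a : k), a ≠ 0 → Θ l = C a * X l → Ψ l = C a⁻¹ * X l := by
  obtain ⟨Ψ, hΨ0, hΨΘ, hΘΨ⟩ := FormalCoordChange.exists_comp_inverse h0 hdet
  have hΨs : HasSubst Ψ := hasSubst_of_constantCoeff_zero hΨ0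
  have hleft : ∀ F, subst Ψ (subst Θ F) = F := fun F => by
    rw [subst_subst_eq_subst_comp h0 hΨ0, show (fun i => subst Ψ (Θ i)) = X from funext hΨΘ, subst_self]; rfl
  have hright : ∀ F, subst Θ (subst Ψ F) = F := fun F => by
    rw [subst_subst_eq_subst_comp hΨ0 h0, show (fun i => subst Θ (Ψ i)) = X from funext hΘΨ, subst_self]; rfl
  refine ⟨Ψ, hΨ0, ?_, hleft, hright, fun l a ha hl => ?_⟩
  · have h1 : FormalCoordChange.linMat (fun i => subst Θ (Ψ i)) = 1 := by
      rw [show (fun i => subst Θ (Ψ i)) = X from funext hΘΨ]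
      ext i j
      simp [FormalCoordChange.linMat, Matrix.one_apply, coeff_X, Finsupp.single_left_inj one_ne_zero, eq_comm]
    have h2 := linMat_comp Ψ h0
    rw [h1] at h2
    have h3 : (FormalCoordChange.linMat Ψ).det * (FormalCoordChange.linMat Θ).det = 1 := by rw [← Matrix.det_mul, ← h2, Matrix.det_one]
    exact IsUnit.of_mul_eq_one _ h3
  · have h := hΨΘ l
    rw [hl, ← coe_substAlgHom hΨs, map_mul, coe_substAlgHom, subst_C, subst_X hΨs] at h
    calc Ψ l = C a⁻¹ * (C a * Ψ l) := by rw [← mul_assoc, ← map_mul, inv_mul_cancel₀ ha, map_one, one_mul]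
      _ = C a⁻¹ * X l := by rw [h]

/-! ## The core identity of the point move at an answer -/

section Core

variable {δ : Decoration k m} {Φ₀ : Fin (m + 1) → MvPowerSeries (Fin (m + 1)) k} {d : ℕ} {A : Fin d → MvPowerSeries (Fin m) k}
  {U : MvPowerSeries (Fin (m + 1)) k}

/-- **THE CORE IDENTITY.**  Let `(Φ₀, 𝟙)` be B-permissible for `δ`, `f ≠ 0`, and let `(f · ∏_{l∈O} x_l) ∘ Φ₀ = U · (y^d + Σ_j A_j y^j)` with
`ord A_j > d − j`.  At an answer `pt` with `A_j ∘ chart(pt′) = s^{d−j+1} B_j`: `satPart(f∘Φ₀∘chart) · W · ∏_{l∈O} (pt_{σl} + y_{σl}) = (U∘chart) · g₀`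
for a unit `W`, `σ = strIdx Φ₀`, `g₀ = (γ + Y)^d + s·Σ_j B_j (γ + Y)^j`. [OURS · L1 W4.3] -/
theorem satPart_fChart_mul_eq (hperm : IsBPermissible δ Φ₀ (fun _ => 1)) (hf : δ.f ≠ 0) (hU : constantCoeff U ≠ 0)
    (hP : subst Φ₀ (δ.f * ∏ l ∈ δ.O, X l) =
      U * (X (Fin.last m) ^ d + ∑ j : Fin d, rename (Fin.succAboveEmb (Fin.last m)) (A j) * X (Fin.last m) ^ (j : ℕ)))
    (pt : Fin (m + 1) → k) (B : Fin d → MvPowerSeries (Fin (m + 1)) k)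
    (hB : ∀ j, subst (CobordantChart.chart (fun _ : Fin m => 1) (fun i => pt (Fin.castSucc i))) (A j) = X 0 ^ (d - (j : ℕ) + 1) * B j) :
    ∃ W : MvPowerSeries (Fin (m + 1 + 1)) k, constantCoeff W ≠ 0 ∧
      satPart (δ.fChart Φ₀ (fun _ => 1) pt) * W * ∏ l ∈ δ.O, (C (pt (strIdx Φ₀ l)) + X (strIdx Φ₀ l).succ) =
        subst (CobordantChart.chart (fun _ : Fin (m + 1) => 1) pt) U *
          ((C (pt (Fin.last m)) + X (Fin.last (m + 1))) ^ d +
            X 0 * ∑ j : Fin d, rename (Fin.succAboveEmb (Fin.last (m + 1))) (B j) * (C (pt (Fin.last m)) + X (Fin.last (m + 1))) ^ (j : ℕ)) := by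
  classical
  obtain ⟨hmv, -, -, hP3⟩ := hperm
  have hΦs : HasSubst Φ₀ := hasSubst_of_constantCoeff_zero hmv.1
  have hconv : ∀ l : Fin (m + 1), (fun _ : Fin (m + 1) => (1 : ℕ)) l = 0 → pt l = 0 := fun l hl => absurd hl one_ne_zero
  have hch := CobordantChart.hasSubst_chart (fun _ : Fin (m + 1) => 1) pt hconv
  -- the straightening units of the old letters
  have hstr : ∀ l ∈ δ.O, ∃ u : MvPowerSeries (Fin (m + 1)) k, constantCoeff u ≠ 0 ∧ Φ₀ l = u * X (strIdx Φ₀ l) :=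
    fun l hl => strIdx_spec (hP3 l (δ.O_subset hl))
  choose! u hu using hstr
  -- the chart transform of the presentation
  have hfChart_ne : δ.fChart Φ₀ (fun _ => 1) pt ≠ 0 := Decoration.fChart_ne_zero hmv hconv hf
  obtain ⟨hsat, hndvd⟩ := satExp_satPart_spec hfChart_ne
  have hT := transform_monic A pt B hB
  rw [cruxChart_one_eq_chart] at hT
  have hl : ∀ l ∈ δ.O, subst (CobordantChart.chart (fun _ : Fin (m + 1) => 1) pt) (subst Φ₀ (X l : MvPowerSeries (Fin (m + 1)) k)) =
      subst (CobordantChart.chart (fun _ : Fin (m + 1) => 1) pt) (u l) * (X 0 * (C (pt (strIdx Φ₀ l)) + X (strIdx Φ₀ l).succ)) := by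
    intro l hlO
    rw [subst_X hΦs, (hu l hlO).2, ← coe_substAlgHom hch, map_mul, coe_substAlgHom, subst_X hch, CobordantChart.chart_apply, pow_one]
  have key : X 0 ^ (satExp (δ.fChart Φ₀ (fun _ => 1) pt) + δ.O.card) *
      (satPart (δ.fChart Φ₀ (fun _ => 1) pt) * (∏ l ∈ δ.O, subst (CobordantChart.chart (fun _ : Fin (m + 1) => 1) pt) (u l)) *
        ∏ l ∈ δ.O, (C (pt (strIdx Φ₀ l)) + X (strIdx Φ₀ l).succ)) =
      X 0 ^ d * (subst (CobordantChart.chart (fun _ : Fin (m + 1) => 1) pt) U *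
        ((C (pt (Fin.last m)) + X (Fin.last (m + 1))) ^ d +
          X 0 * ∑ j : Fin d, rename (Fin.succAboveEmb (Fin.last (m + 1))) (B j) * (C (pt (Fin.last m)) + X (Fin.last (m + 1))) ^ (j : ℕ))) := by
    have h := congrArg (subst (CobordantChart.chart (fun _ : Fin (m + 1) => 1) pt)) hP
    rw [← coe_substAlgHom hΦs, map_mul, map_prod, coe_substAlgHom, ← coe_substAlgHom hch, map_mul, map_mul, map_prod, coe_substAlgHom,
      hT, Finset.prod_congr rfl hl, Finset.prod_mul_distrib, Finset.prod_mul_distrib, Finset.prod_const] at h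
    change δ.fChart Φ₀ (fun _ => 1) pt * _ = _ at h
    rw [hsat] at h
    linear_combination h
  have hW0 : constantCoeff (∏ l ∈ δ.O, subst (CobordantChart.chart (fun _ : Fin (m + 1) => 1) pt) (u l)) ≠ 0 := by
    rw [map_prod]
    refine Finset.prod_ne_zero_iff.mpr fun l hlO => ?_
    rw [constantCoeff_subst_of_constantCoeff_zero _ (CobordantArc.constantCoeff_chart _ pt hconv) (u l)]
    exact (hu l hlO).1
  have hprime := MvPowerSeries.prime_X' k (0 : Fin (m + 1 + 1))
  have hL : ¬ X 0 ∣ satPart (δ.fChart Φ₀ (fun _ => 1) pt) * (∏ l ∈ δ.O, subst (CobordantChart.chart (fun _ : Fin (m + 1) => 1) pt) (u l)) *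
      ∏ l ∈ δ.O, (C (pt (strIdx Φ₀ l)) + X (strIdx Φ₀ l).succ) := by
    intro h
    rcases hprime.dvd_or_dvd h with h | h
    · rcases hprime.dvd_or_dvd h with h | h
      · exact hndvd h
      · exact not_X_dvd_of_constantCoeff_ne_zero hW0 h
    · obtain ⟨l, -, hl'⟩ := (hprime.dvd_finsetProd_iff _).mp h
      exact not_X_zero_dvd_C_add_X_succ _ _ hl'
  have hR : ¬ X 0 ∣ subst (CobordantChart.chart (fun _ : Fin (m + 1) => 1) pt) U *
      ((C (pt (Fin.last m)) + X (Fin.last (m + 1))) ^ d +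
        X 0 * ∑ j : Fin d, rename (Fin.succAboveEmb (Fin.last (m + 1))) (B j) * (C (pt (Fin.last m)) + X (Fin.last (m + 1))) ^ (j : ℕ)) := by
    have h := not_X_zero_dvd_bracket (d := d) U hU ∅ pt
      (∑ j : Fin d, rename (Fin.succAboveEmb (Fin.last (m + 1))) (B j) * (C (pt (Fin.last m)) + X (Fin.last (m + 1))) ^ (j : ℕ))
    rwa [Finset.prod_empty, mul_one] at h
  obtain ⟨-, hGG⟩ := X_pow_mul_eq_X_pow_mul 0 key hL hR
  exact ⟨∏ l ∈ δ.O, subst (CobordantChart.chart (fun _ : Fin (m + 1) => 1) pt) (u l), hW0, hGG⟩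

/-- **ANSWERS WITH `γ = pt(y) ≠ 0` ARE HEAD DROPS**: there the sliced strict transform (at any live slot) is a UNIT. [OURS · L1 W4.3] -/
theorem constantCoeff_strict_ne_zero_of_gamma_ne_zero (hperm : IsBPermissible δ Φ₀ (fun _ => 1)) (hf : δ.f ≠ 0) (hU : constantCoeff U ≠ 0)
    (hA : ∀ j : Fin d, ((d - (j : ℕ) : ℕ) : ℕ∞) < (A j).order)
    (hP : subst Φ₀ (δ.f * ∏ l ∈ δ.O, X l) =
      U * (X (Fin.last m) ^ d + ∑ j : Fin d, rename (Fin.succAboveEmb (Fin.last m)) (A j) * X (Fin.last m) ^ (j : ℕ)))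
    {pt : Fin (m + 1) → k} (hγ : pt (Fin.last m) ≠ 0) (i : Fin (m + 1)) :
    constantCoeff (δ.strict Φ₀ (fun _ => 1) pt i) ≠ 0 := by
  classical
  have hBex : ∀ j : Fin d, ∃ Bj : MvPowerSeries (Fin (m + 1)) k,
      subst (CobordantChart.chart (fun _ : Fin m => 1) (fun i => pt (Fin.castSucc i))) (A j) = X 0 ^ (d - (j : ℕ) + 1) * Bj := fun j =>
    exists_eq_X_pow_mul_of_le_order _ (A j) _ (Order.add_one_le_of_lt (hA j))
  choose B hB using hBex
  obtain ⟨W, hW0, hcore⟩ := satPart_fChart_mul_eq hperm hf hU hP pt B hB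
  have hconv : ∀ l : Fin (m + 1), (fun _ : Fin (m + 1) => (1 : ℕ)) l = 0 → pt l = 0 := fun l hl => absurd hl one_ne_zero
  have hUc : constantCoeff (subst (CobordantChart.chart (fun _ : Fin (m + 1) => 1) pt) U) ≠ 0 := by
    rw [constantCoeff_subst_of_constantCoeff_zero _ (CobordantArc.constantCoeff_chart _ pt hconv) U]; exact hU
  have h := congrArg (fun F => constantCoeff (TupleGame.slice i F)) hcore
  simp only [slice_mul, map_mul, WildTerminal.constantCoeff_slice, constantCoeff_g₀] at h
  intro h0
  unfold Decoration.strict at h0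
  rw [WildTerminal.constantCoeff_slice] at h0
  rw [h0, zero_mul, zero_mul] at h
  exact mul_ne_zero hUc (pow_ne_zero d hγ) h.symm

/-- Hence the new decoration at such an answer has `o′ = 0` (a head drop as soon as `o ≥ 1`; terminal by S-SET (T0)). [OURS · L1 W4.3] -/
theorem o_transform_eq_zero_of_gamma_ne_zero (hperm : IsBPermissible δ Φ₀ (fun _ => 1)) (hf : δ.f ≠ 0) (hU : constantCoeff U ≠ 0)
    (hA : ∀ j : Fin d, ((d - (j : ℕ) : ℕ) : ℕ∞) < (A j).order)
    (hP : subst Φ₀ (δ.f * ∏ l ∈ δ.O, X l) =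
      U * (X (Fin.last m) ^ d + ∑ j : Fin d, rename (Fin.succAboveEmb (Fin.last m)) (A j) * X (Fin.last m) ^ (j : ℕ)))
    {pt : Fin (m + 1) → k} (hγ : pt (Fin.last m) ≠ 0) (i : Fin (m + 1)) :
    (δ.transform Φ₀ (fun _ => 1) pt i).o = 0 := by
  have h0 := constantCoeff_strict_ne_zero_of_gamma_ne_zero hperm hf hU hA hP hγ i
  have hord : (δ.strict Φ₀ (fun _ => 1) pt i).order = 0 := by
    by_contra hne
    exact h0 (order_ne_zero_iff_constCoeff_eq_zero.mp hne)
  have hle := order_sqfRep_le (δ.strict Φ₀ (fun _ => 1) pt i)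
  rw [hord, nonpos_iff_eq_zero] at hle
  rw [Decoration.transform_o, hle]; rfl

open scoped Classical in
/-- **ANSWERS WITH `γ = 0`: THE STRICT TRANSFORM TIMES THE THROUGH-GOING OLD LETTERS IS THE SUCCESSOR MONIC FORM** (up to a unit): at the live
slot `x_{i₀}` (`pt(x_{i₀}) ≠ 0`), `strict · ∏_{l∈O, pt_{σl}=0} x_{σl↓} = V · (y^d + Σ_j (s·B_j)|_{i₀} y^j)` with the weighted brick's `B`. [OURS · L1 W4.3] -/
theorem strict_mul_prod_eq_of_gamma_eq_zero (hperm : IsBPermissible δ Φ₀ (fun _ => 1)) (hf : δ.f ≠ 0) (hU : constantCoeff U ≠ 0)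
    (hA : ∀ j : Fin d, ((d - (j : ℕ) : ℕ) : ℕ∞) < (A j).order)
    (hP : subst Φ₀ (δ.f * ∏ l ∈ δ.O, X l) =
      U * (X (Fin.last m) ^ d + ∑ j : Fin d, rename (Fin.succAboveEmb (Fin.last m)) (A j) * X (Fin.last m) ^ (j : ℕ)))
    {pt : Fin (m + 1) → k} (hγ : pt (Fin.last m) = 0) {i₀ : Fin m} (hci₀ : pt (Fin.castSucc i₀) ≠ 0) :
    ∃ (B : Fin d → MvPowerSeries (Fin (m + 1)) k) (V : MvPowerSeries (Fin (m + 1)) k),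
      (∀ j, subst (CobordantChart.chart (fun _ : Fin m => 1) (fun i => pt (Fin.castSucc i))) (A j) = X 0 ^ (d - (j : ℕ) + 1) * B j) ∧
      constantCoeff V ≠ 0 ∧
      δ.strict Φ₀ (fun _ => 1) pt (Fin.castSucc i₀) *
          ∏ l ∈ δ.O.filter (fun l => pt (strIdx Φ₀ l) = 0), X (Fin.predAbove (Fin.castSucc i₀) (strIdx Φ₀ l).succ) =
        V * (X (Fin.last m) ^ d +
          ∑ j : Fin d, rename (Fin.succAboveEmb (Fin.last m)) (TupleGame.slice i₀ (X 0 * B j)) * X (Fin.last m) ^ (j : ℕ)) := by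
  classical
  have hBex : ∀ j : Fin d, ∃ Bj : MvPowerSeries (Fin (m + 1)) k,
      subst (CobordantChart.chart (fun _ : Fin m => 1) (fun i => pt (Fin.castSucc i))) (A j) = X 0 ^ (d - (j : ℕ) + 1) * Bj := fun j =>
    exists_eq_X_pow_mul_of_le_order _ (A j) _ (Order.add_one_le_of_lt (hA j))
  choose B hB using hBex
  obtain ⟨W, hW0, hcore⟩ := satPart_fChart_mul_eq hperm hf hU hP pt B hB
  have hconv : ∀ l : Fin (m + 1), (fun _ : Fin (m + 1) => (1 : ℕ)) l = 0 → pt l = 0 := fun l hl => absurd hl one_ne_zero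
  set i : Fin (m + 1) := Fin.castSucc i₀ with hi
  have hUc : constantCoeff (subst (CobordantChart.chart (fun _ : Fin (m + 1) => 1) pt) U) ≠ 0 := by
    rw [constantCoeff_subst_of_constantCoeff_zero _ (CobordantArc.constantCoeff_chart _ pt hconv) U]; exact hU
  -- slice the core identity at `x_{i₀}`
  have h := congrArg (TupleGame.slice i) hcore
  have hsplit : ∏ l ∈ δ.O, TupleGame.slice i (C (pt (strIdx Φ₀ l)) + X (strIdx Φ₀ l).succ : MvPowerSeries (Fin (m + 1 + 1)) k) =
      (∏ l ∈ δ.O.filter (fun l => pt (strIdx Φ₀ l) ≠ 0), TupleGame.slice i (C (pt (strIdx Φ₀ l)) + X (strIdx Φ₀ l).succ)) *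
        ∏ l ∈ δ.O.filter (fun l => pt (strIdx Φ₀ l) = 0), X (Fin.predAbove i (strIdx Φ₀ l).succ) := by
    rw [← Finset.prod_filter_mul_prod_filter_not δ.O (fun l => pt (strIdx Φ₀ l) ≠ 0)]
    congr 1
    refine Finset.prod_congr (by ext l; simp) fun l hl => ?_
    have hl0 : pt (strIdx Φ₀ l) = 0 := by simpa using (Finset.mem_filter.mp hl).2
    have hli : strIdx Φ₀ l ≠ i := fun h' => hci₀ (by rw [← h']; exact hl0)
    rw [hl0, map_zero, zero_add, slice_X_succ_of_ne hli]
  have hg₀ : TupleGame.slice i ((C (pt (Fin.last m)) + X (Fin.last (m + 1))) ^ d +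
      X 0 * ∑ j : Fin d, rename (Fin.succAboveEmb (Fin.last (m + 1))) (B j) * (C (pt (Fin.last m)) + X (Fin.last (m + 1))) ^ (j : ℕ)) =
      X (Fin.last m) ^ d + ∑ j : Fin d, rename (Fin.succAboveEmb (Fin.last m)) (TupleGame.slice i₀ (X 0 * B j)) * X (Fin.last m) ^ (j : ℕ) := by
    rw [hγ]; exact slice_g₀ i₀ B
  rw [slice_mul, slice_mul, slice_mul, slice_finset_prod, hsplit, hg₀] at h
  -- divide by the unit
  set Wt : MvPowerSeries (Fin (m + 1)) k := TupleGame.slice i W *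
    ∏ l ∈ δ.O.filter (fun l => pt (strIdx Φ₀ l) ≠ 0), TupleGame.slice i (C (pt (strIdx Φ₀ l)) + X (strIdx Φ₀ l).succ) with hWt
  have hWt0 : constantCoeff Wt ≠ 0 := by
    rw [hWt, map_mul, WildTerminal.constantCoeff_slice, map_prod]
    refine mul_ne_zero hW0 (Finset.prod_ne_zero_iff.mpr fun l hl => ?_)
    rw [WildTerminal.constantCoeff_slice, map_add, constantCoeff_C, constantCoeff_X, add_zero]
    simpa using (Finset.mem_filter.mp hl).2
  obtain ⟨wu, hwu⟩ := isUnit_iff_constantCoeff.mpr (Ne.isUnit hWt0)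
  have hinv0 : constantCoeff (↑wu⁻¹ : MvPowerSeries (Fin (m + 1)) k) ≠ 0 :=
    ((wu⁻¹).isUnit.map (constantCoeff : MvPowerSeries (Fin (m + 1)) k →+* k)).ne_zero
  refine ⟨B, TupleGame.slice i (subst (CobordantChart.chart (fun _ : Fin (m + 1) => 1) pt) U) * ↑wu⁻¹, hB, ?_, ?_⟩
  · rw [map_mul, WildTerminal.constantCoeff_slice]; exact mul_ne_zero hUc hinv0
  · have hkey : δ.strict Φ₀ (fun _ => 1) pt i * Wt *
        ∏ l ∈ δ.O.filter (fun l => pt (strIdx Φ₀ l) = 0), X (Fin.predAbove i (strIdx Φ₀ l).succ) =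
        TupleGame.slice i (subst (CobordantChart.chart (fun _ : Fin (m + 1) => 1) pt) U) * (X (Fin.last m) ^ d +
          ∑ j : Fin d, rename (Fin.succAboveEmb (Fin.last m)) (TupleGame.slice i₀ (X 0 * B j)) * X (Fin.last m) ^ (j : ℕ)) := by
      rw [← h, hWt]; unfold Decoration.strict; ring
    calc δ.strict Φ₀ (fun _ => 1) pt i * ∏ l ∈ δ.O.filter (fun l => pt (strIdx Φ₀ l) = 0), X (Fin.predAbove i (strIdx Φ₀ l).succ)
        = δ.strict Φ₀ (fun _ => 1) pt i * (∏ l ∈ δ.O.filter (fun l => pt (strIdx Φ₀ l) = 0), X (Fin.predAbove i (strIdx Φ₀ l).succ)) *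
            ↑wu * ↑wu⁻¹ := (Units.mul_inv_cancel_right _ wu).symm
      _ = δ.strict Φ₀ (fun _ => 1) pt i * Wt *
            (∏ l ∈ δ.O.filter (fun l => pt (strIdx Φ₀ l) = 0), X (Fin.predAbove i (strIdx Φ₀ l).succ)) * ↑wu⁻¹ := by rw [hwu]; ring
      _ = TupleGame.slice i (subst (CobordantChart.chart (fun _ : Fin (m + 1) => 1) pt) U) * (X (Fin.last m) ^ d +
            ∑ j : Fin d, rename (Fin.succAboveEmb (Fin.last m)) (TupleGame.slice i₀ (X 0 * B j)) * X (Fin.last m) ^ (j : ℕ)) * ↑wu⁻¹ := by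
          rw [hkey]
      _ = _ := by ring

/-- **AT A NEAR POINT THE NEW `f′ · ∏_{O′} x_l` IS THE SUCCESSOR MONIC FORM** (up to a unit): if the order did not drop
(`(δ.transform …).o = δ.o`, so `f′` is the actual sliced strict transform and `O′` the through-going old letters — S-SET 8), then
`f′ · ∏_{l∈O′} x_l = V · (y^d + Σ_j (s·B_j)|_{i₀} y^j)` — by …TOT2BridgeLabels `unit · Θ^*(monic form of the succT-label)`; after `Θ⁻¹`
(`exists_legal_inverse`) this is the presentation `hP` of the next step. [OURS · L1 W4.3] -/
theorem totalO_transform_eq_of_near (hperm : IsBPermissible δ Φ₀ (fun _ => 1)) (hf : δ.f ≠ 0) (hU : constantCoeff U ≠ 0)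
    (hA : ∀ j : Fin d, ((d - (j : ℕ) : ℕ) : ℕ∞) < (A j).order)
    (hP : subst Φ₀ (δ.f * ∏ l ∈ δ.O, X l) =
      U * (X (Fin.last m) ^ d + ∑ j : Fin d, rename (Fin.succAboveEmb (Fin.last m)) (A j) * X (Fin.last m) ^ (j : ℕ)))
    {pt : Fin (m + 1) → k} (hγ : pt (Fin.last m) = 0) {i₀ : Fin m} (hci₀ : pt (Fin.castSucc i₀) ≠ 0)
    (hnear : (δ.transform Φ₀ (fun _ => 1) pt (Fin.castSucc i₀)).o = δ.o) :
    ∃ (B : Fin d → MvPowerSeries (Fin (m + 1)) k) (V : MvPowerSeries (Fin (m + 1)) k),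
      (∀ j, subst (CobordantChart.chart (fun _ : Fin m => 1) (fun i => pt (Fin.castSucc i))) (A j) = X 0 ^ (d - (j : ℕ) + 1) * B j) ∧
      constantCoeff V ≠ 0 ∧
      (δ.transform Φ₀ (fun _ => 1) pt (Fin.castSucc i₀)).f * ∏ l ∈ (δ.transform Φ₀ (fun _ => 1) pt (Fin.castSucc i₀)).O, X l =
        V * (X (Fin.last m) ^ d +
          ∑ j : Fin d, rename (Fin.succAboveEmb (Fin.last m)) (TupleGame.slice i₀ (X 0 * B j)) * X (Fin.last m) ^ (j : ℕ)) := by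
  classical
  have hconv : ∀ l : Fin (m + 1), (fun _ : Fin (m + 1) => (1 : ℕ)) l = 0 → pt l = 0 := fun l hl => absurd hl one_ne_zero
  obtain ⟨B, V, hB, hV, heq⟩ := strict_mul_prod_eq_of_gamma_eq_zero hperm hf hU hA hP hγ hci₀
  refine ⟨B, V, hB, hV, ?_⟩
  have hO : (δ.transform Φ₀ (fun _ => 1) pt (Fin.castSucc i₀)).O = Decoration.newLetters δ.O Φ₀ pt (Fin.castSucc i₀) := by
    refine Decoration.transform_O_of_not_lt δ Φ₀ _ pt _ ?_
    rw [← Decoration.transform_o, hnear]; exact lt_irrefl _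
  rw [Decoration.transform_f_eq_strict_of_o_transform_eq hperm hconv hf hci₀ hnear, hO,
    Decoration.prod_X_newLetters hperm pt hci₀ δ.O_subset]
  exact heq

end Core

end TameFourTupleDrop

end Summit.ResolutionOfSingularities.ResolutionOfSingularities.Theorems
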